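import Literature.NumberTheory.Automorphic.ResidueSubidealCount
import Literature.NumberTheory.Automorphic.EichlerOrderPadicSplitting
import Literature.NumberTheory.Automorphic.QuaternionSubidealCount
import Literature.NumberTheory.Automorphic.BrandtModuleDictionary
import Literature.NumberTheory.Automorphic.BrandtModuleLocal
import Literature.NumberTheory.Automorphic.BrandtModuleChains
import Literature.NumberTheory.Automorphic.BrandtEigenvectorDegreeZero
import HarnessLib

/-!
# Eichler's count: an Eichler order has `p + 1` invertible sub-ideals of index `p²` at `p ∤ N⁺N⁻`;
# column sums `p + 1` of the Brandt matrix `T(p)` and degree zero of cuspidal eigenvectors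

Topic `NumberTheory/Automorphic`; theorems only (no definition, no named fact, no instance).
Assembly of `ResidueSubidealCount.lean` (the count `p + 1` for an order with residue ring
`M₂(𝔽_p)`) with the tree's local machinery:

* `IsMaximalZOrder.natCard_subideals_eq_prime_add_one` — a maximal order `O₁` of a quaternion
  algebra over `ℚ` split at `p` has exactly `p + 1` invertible right sub-ideals of index `p²`
  (residue map from `exists_modPow_reduction`, `EichlerOrderPadicSplitting.lean`: Vignéras II §2
  Thm. 2.3 (1), `O₁/pO₁ ≅ M₂(𝔽_p)`).
* `IsEichlerOrder.natCard_subideals_eq_prime_add_one` — the same inside every invertible right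
  ideal `I` of an Eichler order `O` of level `N` prime to `p`, in a division quaternion algebra:
  by `card_subideals_eq_card_localPrincipal` (`QuaternionSubidealCount.lean`, Kaplansky + gluing)
  the count only depends on `O_(p) = (O₁)_(p)`.
* `Brandt.XiSetup.ncard_subideals_eq_prime_add_one`, `Brandt.XiSetup.sum_matrix_prime_eq` — for a
  Brandt setup of type `(N⁺, N⁻)` and a prime `p ∤ N⁺N⁻`: every representative ideal `I_j` has
  `p + 1` invertible right sub-ideals of index `p²`, i.e. **every column of the Brandt matrix
  `T(p)` sums to `p + 1`** (Eichler 1973, II §6 (16): `B(p)` has row sums `p + 1`; Gross 1987 §1: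
  `deg t_p = p + 1`; Voight 41.1: `T(p)` has constant column sums).
* `Brandt.XiSetup.sum_eq_zero_of_mem_eigenLattice_lFunction'` — hence, unconditionally, **the
  `a(E)`-eigen-lattice of the Brandt matrices of a setup lies in the degree-zero part
  `ℤ[Cls O]⁰`** for every elliptic curve `E/ℚ` (the hypothesis of
  `BrandtEigenvectorDegreeZero.lean` discharged at any prime `p ∤ N⁺N⁻`), the input (M5) of the
  identification `X_r(J₀(rM)) ≅ ℤ[Cls O]⁰` in `TakahashiDegreeFormula.lean` (Ribet 1990 §3).

## References

* M. Eichler, LNM 320 (1973), Ch. II §6 (16) [Eichler1973].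
* B. H. Gross, Heights and the special values of L-series (1987), §1 [Gross1987].
* M.-F. Vignéras, LNM 800 (1980), Ch. II §2 Thm. 2.3, Ch. III §5 Ex. 5.8 (a) [VignerasLNM800].
* J. Voight, *Quaternion Algebras*, GTM 288 (2021), §26.4, §41.1 [Voight2021].
-/

noncomputable section

open scoped TensorProduct Pointwise BigOperators
open NumberField IsDedekindDomain

universe u

namespace Literature.NumberTheory.Automorphic

section DivisionAlgebra

variable {B : Type u} [Ring B] [Algebra ℚ B] [IsQuaternionAlgebra ℚ B]

/-- **A maximal order at a split prime has `p + 1` invertible right sub-ideals of index `p²`**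
(Eichler 1973, II §6 (16); from the residue map `O₁ → M₂(ℤ/p)` of `exists_modPow_reduction` and
`IsMatrixResidueMap.natCard_subideals_eq`). [cite: Eichler1973, Ch. II §6 (16)] -/
theorem IsMaximalZOrder.natCard_subideals_eq_prime_add_one {O₁ : Submodule ℤ B}
    (hO₁ : IsMaximalZOrder O₁) {p : ℕ} [Fact p.Prime]
    (hsplit : Nonempty (ℚ_[p] ⊗[ℚ] B ≃ₐ[ℚ_[p]] Matrix (Fin 2) (Fin 2) ℚ_[p])) :
    Nat.card {M : invertibleRightIdeals O₁ // (M : Submodule ℤ B) ≤ O₁ ∧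
      (M : Submodule ℤ B).toAddSubgroup.relIndex O₁.toAddSubgroup = p ^ 2} = p + 1 := by
  have hp : p.Prime := Fact.out
  obtain ⟨ψ, hadd, hmul, hone, hsurj, hker⟩ := exists_modPow_reduction hO₁ hsplit 1
  haveI : Fact (Nat.Prime (p ^ 1)) := ⟨by rw [pow_one]; exact hp⟩
  have h : IsMatrixResidueMap O₁ p ψ :=
    ⟨hadd, hmul, hone, hsurj, fun x hx => by rw [hker x hx, pow_one]⟩
  exact h.natCard_subideals_eq hO₁.1 hp (by rw [ZMod.card, pow_one])

/-- **Eichler's count for an Eichler order.** Let `O` be an Eichler order of level `N` (an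
intersection of two maximal orders, of index `N` in the first) in a division quaternion algebra
`B` over `ℚ`, `p ∤ N` a prime at which `B` splits, and `I` an invertible right `O`-ideal. Then `I`
has exactly `p + 1` invertible right sub-ideals of index `p²`: the count only depends on `O_(p)`
(`card_subideals_eq_card_localPrincipal`), and `O_(p) = (O₁)_(p)` for the maximal order `O₁ ⊇ O`
of index `N` prime to `p`. [cite: Eichler1973, Ch. II §6 (16)] -/
theorem IsEichlerOrder.natCard_subideals_eq_prime_add_one (hdiv : ∀ x : B, x ≠ 0 → IsUnit x)
    {O : Submodule ℤ B} {N : ℕ} (hO : IsEichlerOrder O N) {p : ℕ} [Fact p.Prime] (hpN : ¬ p ∣ N)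
    (hsplit : Nonempty (ℚ_[p] ⊗[ℚ] B ≃ₐ[ℚ_[p]] Matrix (Fin 2) (Fin 2) ℚ_[p]))
    {I : Submodule ℤ B} (hI : IsInvertibleRightIdeal O I) :
    Nat.card {M : invertibleRightIdeals O // (M : Submodule ℤ B) ≤ I ∧
      (M : Submodule ℤ B).toAddSubgroup.relIndex I.toAddSubgroup = p ^ 2} = p + 1 := by
  have hp : p.Prime := Fact.out
  haveI : IsAddTorsionFree B := isAddTorsionFree_of_charZero_module ℚ B
  have hZ : IsZOrder O := hO.isZOrder
  obtain ⟨O₁, O₂, h₁, h₂, hO12, hidx⟩ := hO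
  rw [card_subideals_eq_card_localPrincipal hdiv hZ hI 2]
  have hle : O ≤ O₁ := hO12 ▸ inf_le_left
  have hN0 : N ≠ 0 := by
    rw [← hidx]
    exact relIndex_ne_zero_of_isFullLattice hZ.isFullLattice h₁.1.isFullLattice.1
  have hloc : localAt p O₁ = localAt p O := by
    refine localAt_eq_of_smul_le hle hN0 (Nat.Coprime.symm (hp.coprime_iff_not_dvd.mpr hpN)) ?_
    intro x hx
    rw [← hidx, natCast_zsmul]
    exact AddSubgroup.nsmul_relIndex_mem O.toAddSubgroup (K := O₁.toAddSubgroup) hx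
  rw [← hloc, ← card_subideals_eq_card_localPrincipal hdiv h₁.1 h₁.1.isInvertibleRightIdeal_self 2]
  exact h₁.natCard_subideals_eq_prime_add_one hsplit

end DivisionAlgebra

/-! ### Brandt setups: column sums of `T(p)` and degree zero of cuspidal eigenvectors -/

namespace Brandt

variable {Nplus Nminus : ℕ}

/-- The algebra of a Brandt setup of type `(N⁺, N⁻)` splits at every prime `p ∤ N⁻` (its
ramified finite places are exactly the primes dividing `N⁻`), over Mathlib's `ℚ_[p]`
(`nonempty_algEquiv_padic_of_isSplitAt`). [folklore] -/
theorem XiSetup.nonempty_algEquiv_padic (S : XiSetup Nplus Nminus) {p : ℕ} [Fact p.Prime]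
    (hpN : ¬ p ∣ Nminus) : Nonempty (ℚ_[p] ⊗[ℚ] S.D ≃ₐ[ℚ_[p]] Matrix (Fin 2) (Fin 2) ℚ_[p]) := by
  have hp : p.Prime := Fact.out
  set v := (Rat.HeightOneSpectrum.primesEquiv (R := 𝓞 ℚ)).symm ⟨p, hp⟩ with hv
  have hvp : ((Rat.HeightOneSpectrum.primesEquiv v : Nat.Primes) : ℕ) = p := by
    rw [hv, Equiv.apply_symm_apply]
  refine nonempty_algEquiv_padic_of_isSplitAt S.D v ?_ p hvp
  by_contra hns
  have hmem : v ∈ ramifiedPlaces ℚ S.D := hns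
  rw [S.ramifiedPlaces_eq, Set.mem_setOf_eq, hvp] at hmem
  exact hpN hmem

/-- The level `N⁺` of a Brandt setup is non-zero (it is the index of the Eichler order in a
maximal order, a finite index of full lattices). [folklore] -/
theorem XiSetup.nplus_ne_zero (S : XiSetup Nplus Nminus) : Nplus ≠ 0 := by
  haveI : IsAddTorsionFree S.D := S.isAddTorsionFree
  obtain ⟨O₁, O₂, h₁, -, hO12, hidx⟩ := S.isEichlerOrder
  rw [← hidx]
  exact relIndex_ne_zero_of_isFullLattice S.isEichlerOrder.isOrder.isFullLattice h₁.1.isFullLattice.1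

/-- **Eichler's count for a Brandt setup**: for a prime `p ∤ N⁺N⁻`, every representative ideal
`I_j` of `Cls O` has exactly `p + 1` invertible right `O`-sub-ideals of index `p²`.
[cite: Eichler1973, Ch. II §6 (16)] -/
theorem XiSetup.ncard_subideals_eq_prime_add_one (S : XiSetup Nplus Nminus) {p : ℕ} (hp : p.Prime)
    (hpN : ¬ p ∣ Nplus * Nminus) (j : ClassSet S.O) :
    {M : Submodule ℤ S.D | M ≤ j.rep ∧ M.toAddSubgroup.relIndex j.rep.toAddSubgroup = p ^ 2 ∧
        M ∈ rightIdeals S.O}.ncard = p + 1 := by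
  haveI : Fact p.Prime := ⟨hp⟩
  have hdiv : ∀ x : S.D, x ≠ 0 → IsUnit x := fun x hx =>
    isUnit_of_isTotallyDefinite S.D S.isTotallyDefinite hx
  have hZ : IsZOrder S.O := isZOrder_iff_isOrder.mpr S.isEichlerOrder.isOrder
  have hE : _root_.Literature.NumberTheory.Automorphic.IsEichlerOrder S.O Nplus :=
    isEichlerOrder_iff_brandt.mpr S.isEichlerOrder
  have hri : rightIdeals S.O = invertibleRightIdeals S.O :=
    rightIdeals_eq_invertibleRightIdeals_of_isTotallyDefinite S.isTotallyDefinite hZ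
  have hI : IsInvertibleRightIdeal S.O j.rep := by
    have hj := j.rep_mem
    rw [hri] at hj
    exact hj
  have hcount := hE.natCard_subideals_eq_prime_add_one hdiv
    (fun h => hpN (dvd_mul_of_dvd_left h Nminus))
    (S.nonempty_algEquiv_padic fun h => hpN (dvd_mul_of_dvd_right h Nplus)) hI
  rw [← hcount, ← Nat.card_coe_set_eq]
  refine Nat.card_congr
    { toFun := fun M => ⟨⟨M.1, by rw [← hri]; exact M.2.2.2⟩, M.2.1, M.2.2.1⟩
      invFun := fun M => ⟨M.1.1, M.2.1, M.2.2, by rw [hri]; exact M.1.2⟩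
      left_inv := fun M => rfl
      right_inv := fun M => rfl }

/-- **The columns of the Brandt matrix `T(p)` sum to `p + 1`** for every prime `p ∤ N⁺N⁻`
(Eichler 1973, II §6 (16); Gross 1987 §1, `deg t_p = p + 1`): the `(1, …, 1)`-row vector is a left
eigenvector of `T(p)` with the Eisenstein eigenvalue `p + 1`. [cite: Eichler1973, Ch. II §6 (16)] -/
theorem XiSetup.sum_matrix_prime_eq (S : XiSetup Nplus Nminus) [Fintype (ClassSet S.O)] {p : ℕ}
    (hp : p.Prime) (hpN : ¬ p ∣ Nplus * Nminus) (j : ClassSet S.O) :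
    ∑ i, matrix S.O p i j = p + 1 := by
  rw [S.sum_matrix_eq_ncard_subideals hp.ne_zero j, S.ncard_subideals_eq_prime_add_one hp hpN j]
  push_cast
  ring

/-- Equivalently: **`(1, …, 1) T(p) = (p + 1) (1, …, 1)`** — the all-ones row vector is a left
eigenvector of `T(p)` for the Eisenstein eigenvalue `p + 1` (`p ∤ N⁺N⁻`). [cite: Eichler1973, Ch. II §6 (16)] -/
theorem XiSetup.one_vecMul_matrix_prime (S : XiSetup Nplus Nminus) [Fintype (ClassSet S.O)] {p : ℕ}
    (hp : p.Prime) (hpN : ¬ p ∣ Nplus * Nminus) :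
    Matrix.vecMul (fun _ => (1 : ℤ)) (matrix S.O p) = fun _ => (p : ℤ) + 1 := by
  funext j
  simp only [Matrix.vecMul, dotProduct, one_mul]
  exact S.sum_matrix_prime_eq hp hpN j

/-- **The `a(E)`-eigen-lattice of a Brandt setup lies in the degree-zero part `ℤ[Cls O]⁰`**,
unconditionally: for every elliptic curve `E/ℚ` (Weierstrass model `W`) and every `v` with
`T(q) v = a_q(E) v` for all primes `q ∤ N⁺N⁻`, `Σ_i v_i = 0` — Eichler's count at any prime
`p ∤ N⁺N⁻` (there is one, `N⁺N⁻ ≠ 0`) feeds `XiSetup.sum_eq_zero_of_mem_eigenLattice_lFunction`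
(`a_p(E) ≠ p + 1` by Hasse). This is input (M5) of `TakahashiDegreeFormula.lean`: the
eigen-lattice cut out in all of `ℤ[Cls O]` already lies in `ℤ[Cls O]⁰ ≅ X_r(J₀(rM))` (Ribet 1990
§3). [cite: Gross1987, §2 (Eisenstein vector and degree)] -/
theorem XiSetup.sum_eq_zero_of_mem_eigenLattice_lFunction' (S : XiSetup Nplus Nminus)
    [Fintype (ClassSet S.O)] (W : WeierstrassCurve ℚ) [W.IsElliptic] {v : ClassSet S.O → ℤ}
    (hv : v ∈ eigenLattice (Nplus * Nminus) (matrix S.O) fun n => W.LFunction n) :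
    ∑ i, v i = 0 := by
  have hN : Nplus * Nminus ≠ 0 := mul_ne_zero S.nplus_ne_zero S.squarefree.ne_zero
  obtain ⟨p, hpgt, hp⟩ := Nat.exists_infinite_primes (Nplus * Nminus + 1)
  have hpN : ¬ p ∣ Nplus * Nminus := fun h => by
    have := Nat.le_of_dvd (Nat.pos_of_ne_zero hN) h
    omega
  exact S.sum_eq_zero_of_mem_eigenLattice_lFunction W hv hp hpN
    fun j => S.ncard_subideals_eq_prime_add_one hp hpN j

/-- The same for a line: the primitive generator `φ` of the `a(E)`-eigen-line has degree zero.
[cite: Gross1987, §2 (Eisenstein vector and degree)] -/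
theorem XiSetup.sum_eq_zero_of_eigenLattice_lFunction_eq_span (S : XiSetup Nplus Nminus)
    [Fintype (ClassSet S.O)] (W : WeierstrassCurve ℚ) [W.IsElliptic] {φ : ClassSet S.O → ℤ}
    (hL : eigenLattice (Nplus * Nminus) (matrix S.O) (fun n => W.LFunction n) = ℤ ∙ φ) :
    ∑ i, φ i = 0 :=
  S.sum_eq_zero_of_mem_eigenLattice_lFunction' W (hL ▸ Submodule.mem_span_singleton_self φ)

end Brandt

end Literature.NumberTheory.Automorphic

end
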